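import Literature.NumberTheory.Automorphic.ArchRankOneSplitOrbitContinuity   -- ★ p850189 (F0P3a-p05 (g19)): `hypBlockGL_mem_of_eq_over`, `exists_glDiagonal_eq_hypBlockGL`, `hypBlockGL_mem_torusU`; brings ★ p850131 `lintegral_descConj_torusU_complex_two_regular_eq_mul_lintegral_prod`, `exists_measure_quotient_torusU_complex_two_eq_smul_map`
import Literature.NumberTheory.Automorphic.ArchRankOneSplitIwasawa           -- ★ p850256 (IWA): `isCompact_range_rotLift`, `exists_rotLift_mul_mem_borelU`, `isHaarMeasure_map_rotLift`, `archPlaneLiftGL_rotMat_add∕_zero∕_neg`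
import Literature.MeasureTheory.Group.InvariantQuotientCompactSubgroup        -- ★ `quotientMeasure_eq_inv_smul_map_mk` (compact subgroup: `ν∕ρ = ρ(T)⁻¹ • π_* ν`)
import Literature.MeasureTheory.Group.InvariantQuotientExistence              -- ★ `quotientMeasure`, `smulInvariantMeasure_quotientMeasure`, `quotientMeasure_ne_zero`
import HarnessLib

/-!
# The ORBITAL MEASURES of the chart points of `U(Φ₂)(ℂ)` as images of FIXED measures on `G × G` — the two «leaves»
# (split place: the `K × N` leaf, Harish-Chandra's `F_f^A` substitution at measure level; compact place: the `G × {1}` leaf)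
# (Rogawski 1990 §4.9, §8.2; Varadarajan 1989 §6.4; Gelbart 1975 Thm. 9.22; Folland 1995 §2.6)

Topic `NumberTheory/Automorphic`; namespaces `Literature.NumberTheory.Automorphic` (§1, group-generic) and `….UnitaryGroup` (§2–§3,
`G = U(conj, J)(ℂ)` with `hJ : J = (StdForm.antidiagonal 2).over ℂ`, so `archLocal L 2 Φ₂ w` qualifies).  THEOREMS ONLY (no `def`, no instance,
no notation, no axiom, no `sorry`).  Cell `pub/hodgecm-mathlib`, crux H413 (`stmt-HodgeConjecture-24833`), line LH3 (closer stub `stub_N9`,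
DIRECT ROAD), organ O-L3′ clause (SB-H) = [C1b] «`stOrbFamH L νH fH S` is `C^∞` on the fundamental slab for GENERAL `fH`» (LH3-plan (g3) RULINGS #7 (d),
2026-09-02), brick (M1b′) «UNIFORM UNFOLDING», per-place half.  Author LH3-p01 (g4).  Count-neutral.

THE POINT.  The product-quotient package (★ `exists_haar_quotientMeasure_prod_pi_top`) writes the chart orbital functional of `H_∞` as an
integral against `⊗_w (ν_w ∕ ρ_w)` on `Π_w (G_w ⧸ T_{S,w})` of `fH(eA⁻¹ (x_w γ_w x_w⁻¹)_w, b)`; pushing each factor forward to `G_w` along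
`x_w T_{S,w} ↦ x_w γ_w x_w⁻¹` gives the ORBITAL MEASURE `O_{γ_w} := (ν_w ∕ ρ_w) ∘ (descConj γ_w T_{S,w} id)⁻¹` of the chart point.  This file writes
`O_γ`, at BOTH kinds of places, as a scalar multiple of the image of ONE FIXED measure `Λ_w` on the COMMON parameter space `G_w × G_w` under the
map `z ↦ z₁ · (γ · z₂) · z₁⁻¹` — so that the product over ALL places is a `Measure.pi` over one index type (no `↥S ∕ ↥Sᶜ` splitting) and,
after the Harish-Chandra substitution at the split places, has NO singularity at the real walls `x_w = 0`:
* §1 (generic `G`, COMPACT closed `T ≤ G`, `γ` centralised by `T`): `O_γ = ρ(T)⁻¹ • (z ↦ z₁ (γ z₂) z₁⁻¹)_* ((g ↦ (g, 1))_* ν)` — the leaf `G × {1}`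
  (★ `quotientMeasure_eq_inv_smul_map_mk`): `map_descConj_quotientMeasure_eq_smul_map_pair_one`.
* §2 (`G = U(Φ₂)(ℂ)`, SPLIT torus `T = torusU`, `t = diag(d) ∈ T` REGULAR, `μ = C • ((k, n) ↦ k n T)_*(κ ⊗ μ_N)`): the MEASURE form of ★
  `lintegral_descConj_torusU_complex_two_regular_eq_mul_lintegral_prod`: `μ ∘ (descConj t T id)⁻¹ = (C · |b − 1|⁻¹) • ((k, n) ↦ k (t n) k⁻¹)_*(κ ⊗ μ_N)`
  (`map_descConj_torusU_complex_two_regular_eq_smul_map`), and at `t = hypBlockGL x θ` (`b = e^{−2x}`, `x ≠ 0`) with the `K × N` leaf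
  `Λ = ((k, n) ↦ (k, n))_*(κ ⊗ μ_N)` on `G × G` (`map_descConj_hypBlockGL_eq_smul_map_leaf`).
* §3 the EXISTENCE PACKAGE at a split place (`exists_splitLeaf_map_descConj_hypBlockGL`): for every non-zero invariant Radon measure `μ` on `U(Φ₂)(ℂ) ⧸ T`
  there are a compact `K ⊆ G` (the Iwasawa circle ★ (IWA)), a measure `Λ` on `G × G` finite on compacta and carried by the closed leaf `K × N`, and
  `C ≠ 0` with `O_{hypBlockGL x θ} = (C · |e^{−2x} − 1|⁻¹) • (z ↦ z₁ (hypBlockGL x θ · z₂) z₁⁻¹)_* Λ` for all `θ` and all `x ≠ 0`; with ★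
  `abs_exp_sub_exp_neg_mul_norm_inv` (`|eˣ − e⁻ˣ| · |e^{−2x} − 1|⁻¹ = eˣ`) the Weyl-normalised orbital measure is `C eˣ •` the image — smooth through
  `x = 0` (Harish-Chandra's `F_f^A`).
HONEST LABEL: HC_CM is proved only modulo the 7 printed citations (2 remaining: hLiu418 = stmt-HodgeConjecture-24832, h413 = stmt-HodgeConjecture-24833)
until rung 0 closes; measure theory over Mathlib + ★ kit, pays nothing by itself.

## References
* [Rogawski1990] J. D. Rogawski, *Automorphic Representations of Unitary Groups in Three Variables*, Ann. of Math. Stud. 123 (1990), §4.9 p. 55, §4.13 p. 70, §8.2 p. 119.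
* [Varadarajan1989] V. S. Varadarajan, *An Introduction to Harmonic Analysis on Semisimple Lie Groups* (1989), §6.4 Lemma 21, Thm 23 (`F_f^A`).
* [Gelbart1975] S. Gelbart, *Automorphic Forms on Adele Groups*, Ann. of Math. Stud. 83, Thm. 9.22 (iii) (the `K T N` integration formula).
* [Folland1995] G. B. Folland, *A Course in Abstract Harmonic Analysis* (1995), §2.6 Thm. 2.49, (2.52) (quotients by compact subgroups).
-/

set_option autoImplicit false

noncomputable section

open MeasureTheory Measure Set Filter Topology
open scoped ENNReal NNReal ComplexConjugate Real MatrixGroups Matrix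

namespace Literature.NumberTheory.Automorphic

open Literature.MeasureTheory.Group

/-! ## §1 Compact torus: the orbital measure is the image of Haar measure — the leaf `G × {1}` -/

section CompactLeaf

variable {G : Type*} [Group G] [TopologicalSpace G] [IsTopologicalGroup G] [LocallyCompactSpace G]
  [SecondCountableTopology G] [T2Space G] [MeasurableSpace G] [BorelSpace G]
  (T : Subgroup G) (hT : IsClosed (T : Set G)) [CompactSpace T]
  (ρ : Measure T) [ρ.IsMulLeftInvariant] [IsFiniteMeasureOnCompacts ρ] [ρ.IsOpenPosMeasure] [SFinite ρ] [ρ.IsInvInvariant]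
  (ν : Measure G) [IsHaarMeasure ν] [ν.IsMulRightInvariant]
  [MeasurableSpace (G ⧸ T)] [BorelSpace (G ⧸ T)]

/-- **COMPACT TORUS: THE ORBITAL MEASURE OF `γ` IS `ρ(T)⁻¹ •` THE IMAGE OF HAAR MEASURE UNDER `g ↦ g γ g⁻¹`** (★ `quotientMeasure_eq_inv_smul_map_mk`:
`ν ∕ ρ = ρ(T)⁻¹ • π_* ν`, then `descConj γ T id ∘ π = (g ↦ g γ g⁻¹)`). [cite: Folland1995, §2.6 Thm. 2.49, (2.52)] -/
theorem map_descConj_quotientMeasure_eq_smul_map_conj (γ : G) (hγ : ∀ m ∈ T, m * γ = γ * m) :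
    Measure.map (descConj γ T hγ id) (quotientMeasure T ρ hT ν) = (ρ Set.univ)⁻¹ • Measure.map (fun g : G => g * γ * g⁻¹) ν := by
  haveI : IsClosed (T : Set G) := hT
  rw [quotientMeasure_eq_inv_smul_map_mk T ρ ν, Measure.map_smul,
    Measure.map_map (continuous_descConj γ T hγ continuous_id).measurable QuotientGroup.continuous_mk.measurable, descConj_comp_mk]
  rfl

/-- **THE LEAF `G × {1}`**: the same orbital measure is `ρ(T)⁻¹ •` the image of `(g ↦ (g, 1))_* ν` under the COMMON parametrisation
`z ↦ z₁ · (γ · z₂) · z₁⁻¹` of `G × G` (on the leaf, `z₂ = 1`).  The scalar is read in `ℝ≥0` (`ρ(T)` is finite and positive).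
[cite: Folland1995, §2.6 (2.52)] [cite: Rogawski1990, §8.2 p. 119] -/
theorem map_descConj_quotientMeasure_eq_smul_map_pair_one (γ : G) (hγ : ∀ m ∈ T, m * γ = γ * m) :
    Measure.map (descConj γ T hγ id) (quotientMeasure T ρ hT ν) =
      ((ρ Set.univ).toNNReal⁻¹ : ℝ≥0) • Measure.map (fun z : G × G => z.1 * (γ * z.2) * z.1⁻¹) (Measure.map (fun g : G => (g, (1 : G))) ν) := by
  have hm : Measurable (fun z : G × G => z.1 * (γ * z.2) * z.1⁻¹) :=
    ((continuous_fst.mul (continuous_const.mul continuous_snd)).mul continuous_fst.inv).measurable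
  have hι : Measurable (fun g : G => (g, (1 : G))) := (continuous_id.prodMk continuous_const).measurable
  rw [map_descConj_quotientMeasure_eq_smul_map_conj T hT ρ ν γ hγ, Measure.map_map hm hι]
  have hfun : ((fun z : G × G => z.1 * (γ * z.2) * z.1⁻¹) ∘ fun g : G => (g, (1 : G))) = fun g : G => g * γ * g⁻¹ := by
    funext g; simp only [Function.comp_apply, mul_one]
  rw [hfun]
  have hne : ρ Set.univ ≠ 0 := (isOpen_univ.measure_pos ρ univ_nonempty).ne'
  have hlt : ρ Set.univ ≠ ⊤ := (isCompact_univ.measure_lt_top (μ := ρ)).ne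
  have hsc : (((ρ Set.univ).toNNReal⁻¹ : ℝ≥0) : ℝ≥0∞) = (ρ Set.univ)⁻¹ := by
    rw [ENNReal.coe_inv ((ENNReal.toNNReal_ne_zero).2 ⟨hne, hlt⟩), ENNReal.coe_toNNReal hlt]
  rw [ENNReal.smul_def, hsc]

end CompactLeaf

namespace UnitaryGroup

open Literature.NumberTheory.Rogawski1990
open Literature.NumberTheory.Automorphic.UnitaryGroup.HeisRing Literature.NumberTheory.Automorphic.UnitaryGroup.LineRing

/-! ## §2 Split torus of `U(Φ₂)(ℂ)`: the measure form of the regular descent, and the `K × N` leaf -/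

section SplitLeaf

variable {J : Matrix (Fin 2) (Fin 2) ℂ} (hJ : J = (StdForm.antidiagonal 2).over ℂ)
  [MeasurableSpace ↥(unitaryGroupOfForm (starRingEnd ℂ) J)] [BorelSpace ↥(unitaryGroupOfForm (starRingEnd ℂ) J)]
  {K : Subgroup ↥(unitaryGroupOfForm (starRingEnd ℂ) J)} (κ : Measure ↥K)
  (μN : Measure ↥(unipotentU (starRingEnd ℂ) J))
  [MeasurableSpace (↥(unitaryGroupOfForm (starRingEnd ℂ) J) ⧸ torusU (starRingEnd ℂ) J)]
  [BorelSpace (↥(unitaryGroupOfForm (starRingEnd ℂ) J) ⧸ torusU (starRingEnd ℂ) J)]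
  (μ : Measure (↥(unitaryGroupOfForm (starRingEnd ℂ) J) ⧸ torusU (starRingEnd ℂ) J))

include hJ in
/-- **MEASURE FORM OF THE REGULAR SPLIT DESCENT**: with `μ = C • ((k, n) ↦ k n T)_* (κ ⊗ μ_N)` on `U(Φ₂)(ℂ) ⧸ T`, `μ_N` a Haar measure of `N`,
`t = diag(d) ∈ T` regular (`b = d₀⁻¹d₁ ≠ 1`): the ORBITAL MEASURE `μ ∘ (yT ↦ y t y⁻¹)⁻¹` on `U(Φ₂)(ℂ)` is
`(C · |b − 1|⁻¹) • ((k, n) ↦ k (t n) k⁻¹)_* (κ ⊗ μ_N)` (★ `lintegral_descConj_torusU_complex_two_regular_eq_mul_lintegral_prod` on indicators).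
[cite: Rogawski1990, §4.9 p. 55; §4.13 p. 70] [cite: Gelbart1975, Thm. 9.22 (iii)] [cite: Varadarajan1989, §6.4 Lemma 21] -/
theorem map_descConj_torusU_complex_two_regular_eq_smul_map [IsHaarMeasure μN] {C : ℝ≥0}
    (hμC : μ = C • Measure.map
      (fun p : ↥K × ↥(unipotentU (starRingEnd ℂ) J) =>
        (QuotientGroup.mk ((p.1 : ↥(unitaryGroupOfForm (starRingEnd ℂ) J)) * (p.2 : ↥(unitaryGroupOfForm (starRingEnd ℂ) J))) :
          ↥(unitaryGroupOfForm (starRingEnd ℂ) J) ⧸ torusU (starRingEnd ℂ) J))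
      (κ.prod μN))
    {t : ↥(unitaryGroupOfForm (starRingEnd ℂ) J)} (ht : t ∈ torusU (starRingEnd ℂ) J) {d : Fin 2 → ℂˣ}
    (hd : glDiagonal 2 ℂ d = (t : GL (Fin 2) ℂ)) (hb : (((d 0)⁻¹ * d 1 : ℂˣ) : ℂ) ≠ 1) :
    Measure.map (descConj t (torusU (starRingEnd ℂ) J) (LineRing.forall_mem_torusU_comm (starRingEnd ℂ) J ht) id) μ =
      (C * ‖(((d 0)⁻¹ * d 1 : ℂˣ) : ℂ) - 1‖₊⁻¹) • Measure.map
        (fun p : ↥K × ↥(unipotentU (starRingEnd ℂ) J) =>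
          (p.1 : ↥(unitaryGroupOfForm (starRingEnd ℂ) J)) * (t * (p.2 : ↥(unitaryGroupOfForm (starRingEnd ℂ) J))) *
            (p.1 : ↥(unitaryGroupOfForm (starRingEnd ℂ) J))⁻¹) (κ.prod μN) := by
  haveI : LocallyCompactSpace ↥(unitaryGroupOfForm (starRingEnd ℂ) J) := locallyCompactSpace_unitaryGroupOfForm_complex J
  haveI : SecondCountableTopology ↥(unitaryGroupOfForm (starRingEnd ℂ) J) := secondCountableTopology_unitaryGroupOfForm_complex J
  haveI : SecondCountableTopology ↥(unipotentU (starRingEnd ℂ) J) := TopologicalSpace.Subtype.secondCountableTopology _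
  haveI : SecondCountableTopology ↥K := TopologicalSpace.Subtype.secondCountableTopology _
  haveI : BorelSpace ↥K := Subtype.borelSpace _
  haveI : BorelSpace ↥(unipotentU (starRingEnd ℂ) J) := Subtype.borelSpace _
  haveI : BorelSpace (↥K × ↥(unipotentU (starRingEnd ℂ) J)) := Prod.borelSpace
  have hdesc : Measurable (descConj t (torusU (starRingEnd ℂ) J) (LineRing.forall_mem_torusU_comm (starRingEnd ℂ) J ht) id) :=
    (continuous_descConj t _ _ continuous_id).measurable
  have hm : Measurable (fun p : ↥K × ↥(unipotentU (starRingEnd ℂ) J) =>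
      (p.1 : ↥(unitaryGroupOfForm (starRingEnd ℂ) J)) * (t * (p.2 : ↥(unitaryGroupOfForm (starRingEnd ℂ) J))) *
        (p.1 : ↥(unitaryGroupOfForm (starRingEnd ℂ) J))⁻¹) :=
    (((continuous_subtype_val.comp continuous_fst).mul (continuous_const.mul (continuous_subtype_val.comp continuous_snd))).mul
      (continuous_subtype_val.comp continuous_fst).inv).measurable
  refine Measure.ext fun s hs => ?_
  rw [Measure.map_apply hdesc hs, Measure.coe_nnreal_smul_apply, Measure.map_apply hm hs, ← lintegral_indicator_one (hdesc hs),
    ← lintegral_indicator_one (hm hs)]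
  have h1 : (fun y => ((descConj t (torusU (starRingEnd ℂ) J) (LineRing.forall_mem_torusU_comm (starRingEnd ℂ) J ht) id) ⁻¹' s).indicator
      (1 : (↥(unitaryGroupOfForm (starRingEnd ℂ) J) ⧸ torusU (starRingEnd ℂ) J) → ℝ≥0∞) y) =
      descConj t (torusU (starRingEnd ℂ) J) (LineRing.forall_mem_torusU_comm (starRingEnd ℂ) J ht)
        (s.indicator (1 : ↥(unitaryGroupOfForm (starRingEnd ℂ) J) → ℝ≥0∞)) := by
    classical
    funext y
    induction y using QuotientGroup.induction_on with
    | H g => simp only [descConj_mk, Set.indicator_apply, Set.mem_preimage, Pi.one_apply, id]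
  have h2 : (fun p : ↥K × ↥(unipotentU (starRingEnd ℂ) J) => ((fun p : ↥K × ↥(unipotentU (starRingEnd ℂ) J) =>
      (p.1 : ↥(unitaryGroupOfForm (starRingEnd ℂ) J)) * (t * (p.2 : ↥(unitaryGroupOfForm (starRingEnd ℂ) J))) *
        (p.1 : ↥(unitaryGroupOfForm (starRingEnd ℂ) J))⁻¹) ⁻¹' s).indicator (1 : ↥K × ↥(unipotentU (starRingEnd ℂ) J) → ℝ≥0∞) p) =
      fun p => s.indicator (1 : ↥(unitaryGroupOfForm (starRingEnd ℂ) J) → ℝ≥0∞)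
        ((p.1 : ↥(unitaryGroupOfForm (starRingEnd ℂ) J)) * (t * (p.2 : ↥(unitaryGroupOfForm (starRingEnd ℂ) J))) *
        (p.1 : ↥(unitaryGroupOfForm (starRingEnd ℂ) J))⁻¹) := by
    classical
    funext p
    simp only [Set.indicator_apply, Set.mem_preimage, Pi.one_apply]
  rw [h1, h2, lintegral_descConj_torusU_complex_two_regular_eq_mul_lintegral_prod hJ κ μN μ hμC ht hd hb (measurable_one.indicator hs),
    ENNReal.coe_mul]

include hJ in
/-- **THE SPLIT ORBITAL MEASURE AT `hypBlockGL x θ = diag(e^{x+iθ}, e^{−x+iθ})`, `x ≠ 0`, ON THE `K × N` LEAF OF `G × G`**: with `Λ = ((k, n) ↦ (k, n))_* (κ ⊗ μ_N)`,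
`μ ∘ (yT ↦ y · hypBlockGL x θ · y⁻¹)⁻¹ = (C · |e^{−2x} − 1|⁻¹) • (z ↦ z₁ · (hypBlockGL x θ · z₂) · z₁⁻¹)_* Λ` (`b = e^{−2x}`, ★ `exists_glDiagonal_eq_hypBlockGL`).
[cite: Varadarajan1989, §6.4 Lemma 21] [cite: Rogawski1990, §8.2 p. 119; §3.6 p. 31] -/
theorem map_descConj_hypBlockGL_eq_smul_map_leaf [IsHaarMeasure μN] {C : ℝ≥0}
    (hμC : μ = C • Measure.map
      (fun p : ↥K × ↥(unipotentU (starRingEnd ℂ) J) =>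
        (QuotientGroup.mk ((p.1 : ↥(unitaryGroupOfForm (starRingEnd ℂ) J)) * (p.2 : ↥(unitaryGroupOfForm (starRingEnd ℂ) J))) :
          ↥(unitaryGroupOfForm (starRingEnd ℂ) J) ⧸ torusU (starRingEnd ℂ) J))
      (κ.prod μN))
    (θ : ℝ) {x : ℝ} (hx : x ≠ 0) :
    Measure.map (descConj (⟨hypBlockGL x θ, hypBlockGL_mem_of_eq_over hJ x θ⟩ : ↥(unitaryGroupOfForm (starRingEnd ℂ) J)) (torusU (starRingEnd ℂ) J)
        (LineRing.forall_mem_torusU_comm (starRingEnd ℂ) J (hypBlockGL_mem_torusU hJ x θ)) id) μ =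
      (C * ‖(((Real.exp (-2 * x) : ℝ) : ℂ)) - 1‖₊⁻¹) • Measure.map
        (fun z : ↥(unitaryGroupOfForm (starRingEnd ℂ) J) × ↥(unitaryGroupOfForm (starRingEnd ℂ) J) =>
          z.1 * ((⟨hypBlockGL x θ, hypBlockGL_mem_of_eq_over hJ x θ⟩ : ↥(unitaryGroupOfForm (starRingEnd ℂ) J)) * z.2) * z.1⁻¹)
        (Measure.map (fun p : ↥K × ↥(unipotentU (starRingEnd ℂ) J) =>
          ((p.1 : ↥(unitaryGroupOfForm (starRingEnd ℂ) J)), (p.2 : ↥(unitaryGroupOfForm (starRingEnd ℂ) J)))) (κ.prod μN)) := by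
  haveI : LocallyCompactSpace ↥(unitaryGroupOfForm (starRingEnd ℂ) J) := locallyCompactSpace_unitaryGroupOfForm_complex J
  haveI : SecondCountableTopology ↥(unitaryGroupOfForm (starRingEnd ℂ) J) := secondCountableTopology_unitaryGroupOfForm_complex J
  haveI : SecondCountableTopology ↥(unipotentU (starRingEnd ℂ) J) := TopologicalSpace.Subtype.secondCountableTopology _
  haveI : SecondCountableTopology ↥K := TopologicalSpace.Subtype.secondCountableTopology _
  haveI : BorelSpace ↥K := Subtype.borelSpace _
  haveI : BorelSpace ↥(unipotentU (starRingEnd ℂ) J) := Subtype.borelSpace _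
  obtain ⟨d, hd, hdd⟩ := exists_glDiagonal_eq_hypBlockGL x θ
  have hd' : glDiagonal 2 ℂ d = (((⟨hypBlockGL x θ, hypBlockGL_mem_of_eq_over hJ x θ⟩ : ↥(unitaryGroupOfForm (starRingEnd ℂ) J))) : GL (Fin 2) ℂ) := hd
  have hb : (((d 0)⁻¹ * d 1 : ℂˣ) : ℂ) ≠ 1 := by
    rw [hdd, ← Complex.ofReal_one, Ne, Complex.ofReal_inj, Real.exp_eq_one_iff]
    intro h
    exact hx (by linarith)
  haveI : BorelSpace (↥K × ↥(unipotentU (starRingEnd ℂ) J)) := Prod.borelSpace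
  have hm : Measurable (fun z : ↥(unitaryGroupOfForm (starRingEnd ℂ) J) × ↥(unitaryGroupOfForm (starRingEnd ℂ) J) =>
      z.1 * ((⟨hypBlockGL x θ, hypBlockGL_mem_of_eq_over hJ x θ⟩ : ↥(unitaryGroupOfForm (starRingEnd ℂ) J)) * z.2) * z.1⁻¹) :=
    ((continuous_fst.mul (continuous_const.mul continuous_snd)).mul continuous_fst.inv).measurable
  have hι : Measurable (fun p : ↥K × ↥(unipotentU (starRingEnd ℂ) J) =>
      ((p.1 : ↥(unitaryGroupOfForm (starRingEnd ℂ) J)), (p.2 : ↥(unitaryGroupOfForm (starRingEnd ℂ) J)))) :=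
    ((continuous_subtype_val.comp continuous_fst).prodMk (continuous_subtype_val.comp continuous_snd)).measurable
  rw [map_descConj_torusU_complex_two_regular_eq_smul_map hJ κ μN μ hμC (hypBlockGL_mem_torusU hJ x θ) hd' hb, hdd, Measure.map_map hm hι]
  rfl

end SplitLeaf

/-! ## §3 The existence package at a split place: Iwasawa circle `K`, the leaf measure `Λ` on `G × G`, the constant `C` -/

section SplitPackage

variable {J : Matrix (Fin 2) (Fin 2) ℂ} (hJ : J = (StdForm.antidiagonal 2).over ℂ)
  [MeasurableSpace ↥(unitaryGroupOfForm (starRingEnd ℂ) J)] [BorelSpace ↥(unitaryGroupOfForm (starRingEnd ℂ) J)]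
  [MeasurableSpace (↥(unitaryGroupOfForm (starRingEnd ℂ) J) ⧸ torusU (starRingEnd ℂ) J)]
  [BorelSpace (↥(unitaryGroupOfForm (starRingEnd ℂ) J) ⧸ torusU (starRingEnd ℂ) J)]
  (μ : Measure (↥(unitaryGroupOfForm (starRingEnd ℂ) J) ⧸ torusU (starRingEnd ℂ) J))
  [SMulInvariantMeasure ↥(unitaryGroupOfForm (starRingEnd ℂ) J) (↥(unitaryGroupOfForm (starRingEnd ℂ) J) ⧸ torusU (starRingEnd ℂ) J) μ]
  [IsFiniteMeasureOnCompacts μ]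

include hJ in
/-- **THE SPLIT-PLACE LEAF PACKAGE.**  For every non-zero invariant Radon measure `μ` on `U(Φ₂)(ℂ) ⧸ T` (`T` the split torus) there are: a COMPACT
`K ⊆ U(Φ₂)(ℂ)` (the Iwasawa circle ★ (IWA), `U(Φ₂)(ℂ) = K · B`), a measure `Λ` on `U(Φ₂)(ℂ) × U(Φ₂)(ℂ)` FINITE ON COMPACTA and CARRIED BY THE CLOSED LEAF `K × N`
(`Λ = ((k, n) ↦ (k, n))_* (κ ⊗ μ_N)`), and `C ≠ 0`, such that for EVERY `θ` and every `x ≠ 0` the orbital measure of `hypBlockGL x θ` is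
`μ ∘ (yT ↦ y · hypBlockGL x θ · y⁻¹)⁻¹ = (C · |e^{−2x} − 1|⁻¹) • (z ↦ z₁ · (hypBlockGL x θ · z₂) · z₁⁻¹)_* Λ`.
(With ★ `abs_exp_sub_exp_neg_mul_norm_inv`, `|eˣ − e⁻ˣ| •` it `= C eˣ •` the image: no singularity at `x = 0`.)
[cite: Varadarajan1989, §6.4 Lemma 21, Thm 23] [cite: Gelbart1975, Thm. 9.22 (iii)] [cite: Rogawski1990, §4.9 p. 55; §8.2 p. 119] -/
theorem exists_splitLeaf_map_descConj_hypBlockGL (hμ : μ ≠ 0) :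
    ∃ (K : Set ↥(unitaryGroupOfForm (starRingEnd ℂ) J)) (_ : IsCompact K)
      (Λ : Measure (↥(unitaryGroupOfForm (starRingEnd ℂ) J) × ↥(unitaryGroupOfForm (starRingEnd ℂ) J))) (_ : IsFiniteMeasureOnCompacts Λ) (C : ℝ≥0),
      C ≠ 0 ∧ Λ (K ×ˢ (unipotentU (starRingEnd ℂ) J : Set ↥(unitaryGroupOfForm (starRingEnd ℂ) J)))ᶜ = 0 ∧
      ∀ (θ x : ℝ), x ≠ 0 →
        Measure.map (descConj (⟨hypBlockGL x θ, hypBlockGL_mem_of_eq_over hJ x θ⟩ : ↥(unitaryGroupOfForm (starRingEnd ℂ) J)) (torusU (starRingEnd ℂ) J)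
            (LineRing.forall_mem_torusU_comm (starRingEnd ℂ) J (hypBlockGL_mem_torusU hJ x θ)) id) μ =
          (C * ‖(((Real.exp (-2 * x) : ℝ) : ℂ)) - 1‖₊⁻¹) • Measure.map
            (fun z : ↥(unitaryGroupOfForm (starRingEnd ℂ) J) × ↥(unitaryGroupOfForm (starRingEnd ℂ) J) =>
              z.1 * ((⟨hypBlockGL x θ, hypBlockGL_mem_of_eq_over hJ x θ⟩ : ↥(unitaryGroupOfForm (starRingEnd ℂ) J)) * z.2) * z.1⁻¹) Λ := by
  haveI : Fact (0 < 2 * π) := ⟨Real.two_pi_pos⟩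
  -- instances on `G`, `T`, `N`
  haveI : LocallyCompactSpace ↥(unitaryGroupOfForm (starRingEnd ℂ) J) := locallyCompactSpace_unitaryGroupOfForm_complex J
  haveI : SecondCountableTopology ↥(unitaryGroupOfForm (starRingEnd ℂ) J) := secondCountableTopology_unitaryGroupOfForm_complex J
  have hT : IsClosed (torusU (starRingEnd ℂ) J : Set ↥(unitaryGroupOfForm (starRingEnd ℂ) J)) := isClosed_torusU_two _ _
  have hN : IsClosed (unipotentU (starRingEnd ℂ) J : Set ↥(unitaryGroupOfForm (starRingEnd ℂ) J)) := isClosed_unipotentU _ _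
  haveI : LocallyCompactSpace ↥(torusU (starRingEnd ℂ) J) := hT.isClosedEmbedding_subtypeVal.locallyCompactSpace
  haveI : LocallyCompactSpace ↥(unipotentU (starRingEnd ℂ) J) := hN.isClosedEmbedding_subtypeVal.locallyCompactSpace
  haveI : SecondCountableTopology ↥(unipotentU (starRingEnd ℂ) J) := TopologicalSpace.Subtype.secondCountableTopology _
  haveI : BorelSpace ↥(torusU (starRingEnd ℂ) J) := Subtype.borelSpace _
  haveI : BorelSpace ↥(unipotentU (starRingEnd ℂ) J) := Subtype.borelSpace _
  -- the circle `K₁` as a subgroup, compact, with `G = K₁ · B`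
  set ι : AddCircle (2 * π) → ↥(unitaryGroupOfForm (starRingEnd ℂ) J) :=
    fun s => ⟨archPlaneLiftGL 1 (rotMat s) (det_rotMat s), archPlaneLiftGL_rotMat_mem hJ s⟩ with hι
  have hιadd : ∀ s t, ι (s + t) = ι s * ι t := fun s t => Subtype.ext (archPlaneLiftGL_rotMat_add s t)
  have hι0 : ι 0 = 1 := Subtype.ext archPlaneLiftGL_rotMat_zero
  have hιneg : ∀ s, ι (-s) = (ι s)⁻¹ := fun s => Subtype.ext (by
    rw [Subgroup.coe_inv]; exact archPlaneLiftGL_rotMat_neg s)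
  let K : Subgroup ↥(unitaryGroupOfForm (starRingEnd ℂ) J) :=
    { carrier := Set.range ι
      one_mem' := ⟨0, hι0⟩
      mul_mem' := by
        rintro _ _ ⟨s, rfl⟩ ⟨t, rfl⟩
        exact ⟨s + t, hιadd s t⟩
      inv_mem' := by
        rintro _ ⟨s, rfl⟩
        exact ⟨-s, hιneg s⟩ }
  have hKmem : ∀ s, ι s ∈ K := fun s => ⟨s, rfl⟩
  have hKmem' : ∀ k ∈ K, ∃ s, k = ι s := fun k ⟨s, hs⟩ => ⟨s, hs.symm⟩
  have hK : IsCompact (K : Set ↥(unitaryGroupOfForm (starRingEnd ℂ) J)) := isCompact_range_rotLift hJ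
  have hKB : ∀ g : ↥(unitaryGroupOfForm (starRingEnd ℂ) J), ∃ k ∈ K, ∃ b ∈ borelU (starRingEnd ℂ) J, g = k * b := by
    intro g
    obtain ⟨s, b, hb, hg⟩ := exists_rotLift_mul_mem_borelU hJ g
    exact ⟨ι s, hKmem s, b, hb, hg⟩
  haveI : CompactSpace ↥K := isCompact_iff_compactSpace.1 hK
  haveI : BorelSpace ↥K := Subtype.borelSpace _
  -- Haar measures: `κ` on `K` (the image of `ds`), `α` on `T`, `μ_N` on `N`
  set κ : Measure ↥K := Measure.map (fun s : AddCircle (2 * π) => (⟨ι s, hKmem s⟩ : ↥K)) (volume : Measure (AddCircle (2 * π))) with hκ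
  haveI : IsHaarMeasure κ := isHaarMeasure_map_rotLift hJ K hKmem hKmem'
  obtain ⟨α, hα⟩ : ∃ α : Measure ↥(torusU (starRingEnd ℂ) J), α.IsHaarMeasure := ⟨Measure.haar, inferInstance⟩
  obtain ⟨μN, hμN⟩ : ∃ μN : Measure ↥(unipotentU (starRingEnd ℂ) J), μN.IsHaarMeasure := ⟨Measure.haar, inferInstance⟩
  obtain ⟨C, hC, hμC⟩ := exists_measure_quotient_torusU_complex_two_eq_smul_map hJ hK hKB κ α μN μ hμ
  -- the leaf measure
  set Λ : Measure (↥(unitaryGroupOfForm (starRingEnd ℂ) J) × ↥(unitaryGroupOfForm (starRingEnd ℂ) J)) :=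
    Measure.map (fun p : ↥K × ↥(unipotentU (starRingEnd ℂ) J) =>
      ((p.1 : ↥(unitaryGroupOfForm (starRingEnd ℂ) J)), (p.2 : ↥(unitaryGroupOfForm (starRingEnd ℂ) J)))) (κ.prod μN) with hΛ
  have hleaf : IsClosedEmbedding (fun p : ↥K × ↥(unipotentU (starRingEnd ℂ) J) =>
      ((p.1 : ↥(unitaryGroupOfForm (starRingEnd ℂ) J)), (p.2 : ↥(unitaryGroupOfForm (starRingEnd ℂ) J)))) :=
    hK.isClosed.isClosedEmbedding_subtypeVal.prodMap hN.isClosedEmbedding_subtypeVal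
  have hΛc : IsFiniteMeasureOnCompacts Λ := by
    refine ⟨fun C' hC' => ?_⟩
    rw [hΛ, hleaf.measurableEmbedding.map_apply]
    exact (hleaf.isCompact_preimage hC').measure_lt_top
  refine ⟨(K : Set ↥(unitaryGroupOfForm (starRingEnd ℂ) J)), hK, Λ, hΛc, C, hC, ?_, fun θ x hx => ?_⟩
  · rw [hΛ, hleaf.measurableEmbedding.map_apply]
    have hempty : (fun p : ↥K × ↥(unipotentU (starRingEnd ℂ) J) =>
        ((p.1 : ↥(unitaryGroupOfForm (starRingEnd ℂ) J)), (p.2 : ↥(unitaryGroupOfForm (starRingEnd ℂ) J)))) ⁻¹'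
          ((K : Set ↥(unitaryGroupOfForm (starRingEnd ℂ) J)) ×ˢ (unipotentU (starRingEnd ℂ) J : Set ↥(unitaryGroupOfForm (starRingEnd ℂ) J)))ᶜ = ∅ := by
      ext p
      simp only [Set.mem_preimage, Set.mem_compl_iff, Set.mem_prod, Subtype.coe_prop, and_self, not_true_eq_false,
        Set.mem_empty_iff_false]
    rw [hempty, measure_empty]
  · exact map_descConj_hypBlockGL_eq_smul_map_leaf hJ κ μN μ hμC θ hx

end SplitPackage

end UnitaryGroup

end Literature.NumberTheory.Automorphic

end
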